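import Literature.Geometry.Kaehler.ComplexTorusWeylOperatorIntegral
import Literature.Geometry.Kaehler.ComplexTorusDualAbelianVariety
import Literature.Algebra.Lie.LefschetzModuleSL2Representation
import HarnessLib

/-!
# Closed forms of the cohomological Fourier transform of a polarised complex torus:
# `φ^* ∘ F = (−1)^g χ(d) · exp(−L_η) exp(Λ_η) exp(−L_η)` (Polishchuk's Lemma 1.4 AS PRINTED, with `e = c₁(L) ∪ · = −L_η`),
# `F = (−1)^g χ(d) · (φ_H⁻¹)^* ∘ w`, and `w(Hᵏ) ⊆ H^{2g−k}`

Layer `Literature/Geometry/Kaehler`, namespace `Literature.Geometry.Kaehler.ComplexTorus`; lane `lit-hodgefound` (Track 2 foundations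
library), prover seat `lit-hodgefound-p09` (generation 51, row g51-#8). THEOREMS ONLY (no definition, no named fact, no instance, no
notation; D-0026 net debt `0`). Sequel of rows g51-#4 (`φ^* ∘ F = (−1)^g χ(d)·w`, `w = exp(Λ_η) exp(−L_η) exp(Λ_η)`) and g51-#5.

Polishchuk's printed Weyl word is `exp(e) exp(−f) exp(e)` with `e = ` (cup product with the polarisation class `c₁(L)`) and `f` its
`𝔰𝔩₂`-partner; in the tree's conventions `c₁(L) = −E = −η` (Lemma 1.7.4; `ofRealForm (−η)` is the Chern form), so `e = −L_η` and
`f = −Λ_η` (`(−L, −Λ, H)` is again an `𝔰𝔩₂`-triple), and his word is `exp(−L_η) exp(Λ_η) exp(−L_η)` — the SECOND Weyl word of the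
tree's triple, equal to the tree's `w = exp(Λ_η) exp(−L_η) exp(Λ_η)` by the braid relation of the `SL₂`-representation
(`torus_mul_weylOperator_eq_exp_e` at `c = 1`: both words represent `(0 1 ; −1 0)`).

## What is proved

* §1 **`weylOperator_eq_exp_neg_lefschetzG_mul` : `w = exp(−L_η) exp(Λ_η) exp(−L_η)`** on `H•(X; ℂ)` (the tree's explicit `Λ_η = lefschetzDualG η`),
  **`isHomog_weylOperator_of`, `weylOperator_of_apply_of_ne`: `w(Hᵏ) ⊆ H^{2g−k}`** (`w M_m ⊆ M_{−m}`, André) — for every non-degenerate `η`.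
* §2 **`IsPolarizationType.of_fourierForm_compContinuousLinearMap_eq_smul_exp_mul_exp_mul_exp`:
  `φ^*F(x) = (−1)^g χ(d) · (exp(−L_η) exp(Λ_η) exp(−L_η))(x)`** for a polarisation of type `d` — Polishchuk's
  "`(−1)^g F_d = exp(e) exp(−f) exp(e)`", `F_d = χ(d)⁻¹ φ^* ∘ F`, AS PRINTED (with `e = −L_η`, `f = −Λ_η`); principal case
  `IsPrincipalPolarization.of_fourierForm_comp_phiHRep_eq_smul_exp_mul_exp_mul_exp`.
* §3 **`IsPolarizationType.fourierForm_eq_smul_weylOperator_compContinuousLinearMap_phiHEquiv_symm`: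
  `F(x) = (−1)^g χ(d) · (φ_H⁻¹)^*(w(x)_m)`** — THE FOURIER TRANSFORM ITSELF as the Weyl operator followed by transport to `X̂` along
  the `ℂ`-linear isomorphism `φ_H : V ⥲ Ω̄` (`phiHEquiv`; `η` non-degenerate of type `(1,1)`), `k + m = 2g`.

## Sources, VERBATIM

* A. Polishchuk, *Fourier-stable subrings in the Chow rings of abelian varieties* (2007) [Polishchuk2007FourierStable], §1 p. 3 (held text
  `paper:arxiv-0705.0772`, p0003 L69–L110): "`e(x) = d·x`" (`d` the polarisation class), "`F_d = (1/χ(d)) φ^* ∘ F`",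
  "**Lemma 1.4.** The operators `F_d`, `e` and `f` associated with a polarization `d` on an abelian scheme `A/S` satisfy
  `(−1)^g F_d = exp(e) exp(−f) exp(e)`."
* A. Beauville, *Le groupe SL₂ et les variétés abéliennes* (2010) [Beauville2010SL2], §3 Theorem (proof: the braid relation "`v = uwu`").
* Y. André, *Pour une théorie inconditionnelle des motifs* (1996) [Andre1996Motifs], §1.2 (p. 11).
* H. Lange, *Abelian Varieties over the Complex Numbers* (2023) [Lange2023AbelianVarietiesComplex], §6.2.4 (6.11), Prop. 6.2.20 (p. 310);
  §1.4.2 Lemma 1.4.5 (`φ_H`); §1.7.2 Lemma 1.7.4 (`c₁(L) = −E`).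

## Scope

The exponentials are Mathlib's `IsNilpotent.exp` in the `ℚ`-algebra structure of `End_ℂ(H•(X; ℂ))` through `ℚ → ℂ` (as in the tree's
`weylOperator`); no Chow-theoretic statement; the dictionary `e = −L_η` is the tree's sign convention for `c₁(L)`, recorded here, not a theorem.
-/

noncomputable section

-- `Module ℂ` / `SMulZeroClass ℂ` synthesis on `E [⋀^Fin k]→L[ℝ] ℂ` (as in `ComplexTorusLefschetzDecomposition`)
set_option maxSynthPendingDepth 3

namespace Literature.Geometry.Kaehler

namespace ComplexTorus

open Module Function Finset
open Literature.LinearAlgebra.Alternating Literature.Algebra.Lie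

universe uE

variable {ι : Type*} [Fintype ι] [DecidableEq ι] {E : Type uE} [NormedAddCommGroup E] [NormedSpace ℂ E]
  [FiniteDimensional ℂ E] [Nontrivial E] (Φ : (ι → ℝ) ≃L[ℝ] E) {η : E [⋀^Fin 2]→L[ℝ] ℝ} {N : ℕ}

/-! ## §1 The second Weyl word and the degree of `w` -/

section WeylWord

omit [Fintype ι] [DecidableEq ι] in
/-- **`w = exp(−L_η) exp(Λ_η) exp(−L_η)`**: the tree's Weyl operator `exp(Λ_η) exp(−L_η) exp(Λ_η)` of the Lefschetz `𝔰𝔩₂` of a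
non-degenerate `η` equals the other Weyl word (the braid relation `torus_mul_weylOperator_eq_exp_e` at `c = 1`; `Λ_η = lefschetzDualG η`
is the abstract partner, `dual_lefschetzG_eq_lefschetzDualG`). With `e := −L_η = c₁(L) ∪ ·`, `f := −Λ_η` this is Polishchuk's word
`exp(e) exp(−f) exp(e)`. [cite: Beauville2010SL2, §3 Theorem (proof)] [cite: Andre1996Motifs, §1.2 (p. 11)] [cite: Polishchuk2007FourierStable, §1 Lemma 1.4 (p. 3)] -/
theorem weylOperator_eq_exp_neg_lefschetzG_mul (hη : ∀ v : E, v ≠ 0 → ∃ w : E, η ![v, w] ≠ 0) :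
    letI := Algebra.compHom (Module.End ℂ (GForm E ℂ)) (algebraMap ℚ ℂ)
    (hasLefschetzProperty_lefschetzG hη).weylOperator isZGrading_countingG =
      IsNilpotent.exp (-lefschetzG η) * IsNilpotent.exp (lefschetzDualG η) * IsNilpotent.exp (-lefschetzG η) := by
  letI := Algebra.compHom (Module.End ℂ (GForm E ℂ)) (algebraMap ℚ ℂ)
  have h := (hasLefschetzProperty_lefschetzG hη).torus_mul_weylOperator_eq_exp_e isZGrading_countingG (one_ne_zero (α := ℂ))
  rwa [IsZGrading.torus_one, one_mul, one_smul, inv_one, one_smul, dual_lefschetzG_eq_lefschetzDualG hη] at h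

omit [Fintype ι] [DecidableEq ι] in
/-- **`w(Hᵏ) ⊆ H^{2g−k}`**: the Weyl operator carries a homogeneous form of degree `k` to a homogeneous graded form of degree `m`,
`k + m = 2g` (`w M_j ⊆ M_{−j}` with `M_{k−g} = Hᵏ`). [cite: Andre1996Motifs, §1.2 (p. 11)] [cite: Huybrechts2005, §1.2 Def. 1.2.25] -/
theorem isHomog_weylOperator_of (hη : ∀ v : E, v ≠ 0 → ∃ w : E, η ![v, w] ≠ 0) {k m : ℕ} (h : k + m = 2 * finrank ℂ E)
    (x : E [⋀^Fin k]→L[ℝ] ℂ) :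
    GForm.IsHomog m ((hasLefschetzProperty_lefschetzG hη).weylOperator isZGrading_countingG (GForm.of k x)) := by
  have h1 := (hasLefschetzProperty_lefschetzG hη).weylOperator_apply_mem isZGrading_countingG (of_mem_degreeSpace_countingG (E := E) k x)
  rw [show -((k : ℤ) - (finrank ℂ E : ℤ)) = (m : ℤ) - (finrank ℂ E : ℤ) by omega] at h1
  exact mem_degreeSpace_countingG_iff.1 h1

omit [Fintype ι] [DecidableEq ι] in
/-- The components of `w(x)`, `x ∈ Hᵏ`, vanish outside degree `2g − k`. [cite: Andre1996Motifs, §1.2 (p. 11)] -/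
theorem weylOperator_of_apply_of_ne (hη : ∀ v : E, v ≠ 0 → ∃ w : E, η ![v, w] ≠ 0) {k m m' : ℕ} (h : k + m = 2 * finrank ℂ E)
    (hm' : m' ≠ m) (x : E [⋀^Fin k]→L[ℝ] ℂ) :
    (hasLefschetzProperty_lefschetzG hη).weylOperator isZGrading_countingG (GForm.of k x) m' = 0 :=
  isHomog_weylOperator_of hη h x m' hm'

end WeylWord

/-! ## §2 Polishchuk's Lemma 1.4 as printed: `φ^* ∘ F = (−1)^g χ(d) · exp(−L_η) exp(Λ_η) exp(−L_η)` -/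

section Polishchuk

/-- **`φ^*F(x) = (−1)^g χ(d) · (exp(−L_η) exp(Λ_η) exp(−L_η))(x)`** for every `x ∈ Hᵏ(X; ℂ)` (placed in degree `m`, `k + m = 2g`), every
Riemann form `η` of type `d = (d₁, …, d_g)` (`χ(d) = d₁⋯d_g`), every real-linear `φ` with `Im φ(u)(w) = η(u, w)` and every lattice frame
`e` — POLISHCHUK'S LEMMA 1.4 "`(−1)^g F_d = exp(e) exp(−f) exp(e)`", `F_d = χ(d)⁻¹ φ^* ∘ F`, read with his `e = c₁(L) ∪ · = −L_η`,
`f = −Λ_η` (the tree's `c₁(L) = −η`). [cite: Polishchuk2007FourierStable, §1 Lemma 1.4 (p. 3)] [cite: Beauville2010SL2, §3 Theorem (proof)]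
[cite: Lange2023AbelianVarietiesComplex, §6.2.4 Prop. 6.2.20 p. 310; §1.7.2 Lemma 1.7.4] -/
theorem IsPolarizationType.of_fourierForm_compContinuousLinearMap_eq_smul_exp_mul_exp_mul_exp (hR : IsRiemannForm Φ η) {g : ℕ}
    {d : Fin g → ℕ} (hd : IsPolarizationType Φ η d) (hη : ∀ v : E, v ≠ 0 → ∃ w : E, η ![v, w] ≠ 0) (φ : E →L[ℝ] (E →L⋆[ℂ] ℂ))
    (hφ : ∀ u w, (φ u w).im = η ![u, w]) (e : Fin N ≃ ι) {k m : ℕ} (h : k + m = N) (x : E [⋀^Fin k]→L[ℝ] ℂ) :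
    letI := Algebra.compHom (Module.End ℂ (GForm E ℂ)) (algebraMap ℚ ℂ)
    GForm.of m ((fourierForm Φ e h x).compContinuousLinearMap φ) =
      ((-1 : ℂ) ^ g * ∏ i, (d i : ℂ)) •
        (IsNilpotent.exp (-lefschetzG η) * IsNilpotent.exp (lefschetzDualG η) * IsNilpotent.exp (-lefschetzG η)) (GForm.of k x) := by
  rw [← weylOperator_eq_exp_neg_lefschetzG_mul hη]
  exact hd.of_fourierForm_compContinuousLinearMap Φ hR hη φ hφ e h x

/-- **`φ_H^*F(x) = (−1)^g · (exp(−L_η) exp(Λ_η) exp(−L_η))(x)` for a principally polarised complex torus** (`χ = 1`, `φ = φ_H`,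
`g = dim_ℂ X`): "`(−1)^g F_d = exp(e) exp(−f) exp(e)`" with `F_d = φ_H^* ∘ F`. [cite: Polishchuk2007FourierStable, §1 Lemma 1.4 (p. 3)]
[cite: Beauville2010SL2, §3 Theorem (proof)] -/
theorem IsPrincipalPolarization.of_fourierForm_comp_phiHRep_eq_smul_exp_mul_exp_mul_exp (hp : IsPrincipalPolarization Φ η)
    (hη : ∀ v : E, v ≠ 0 → ∃ w : E, η ![v, w] ≠ 0) (e : Fin N ≃ ι) {k m : ℕ} (h : k + m = N) (x : E [⋀^Fin k]→L[ℝ] ℂ) :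
    letI := Algebra.compHom (Module.End ℂ (GForm E ℂ)) (algebraMap ℚ ℂ)
    GForm.of m ((fourierForm Φ e h x).compContinuousLinearMap ((phiHRep Φ hp.isRiemannForm.1).restrictScalars ℝ)) =
      ((-1 : ℂ) ^ finrank ℂ E) •
        (IsNilpotent.exp (-lefschetzG η) * IsNilpotent.exp (lefschetzDualG η) * IsNilpotent.exp (-lefschetzG η)) (GForm.of k x) := by
  rw [← weylOperator_eq_exp_neg_lefschetzG_mul hη]
  exact hp.of_fourierForm_comp_phiHRep Φ hη e h x

end Polishchuk

/-! ## §3 The Fourier transform itself: `F = (−1)^g χ(d) · (φ_H⁻¹)^* ∘ w` -/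

section FourierClosedForm

omit [Fintype ι] [DecidableEq ι] [FiniteDimensional ℂ E] [Nontrivial E] in
/-- `g^*(c T) = c g^*T`. [cite: Warner1983, 2.22] -/
private theorem smul_compContinuousLinearMap₅₆ {V W : Type*} [NormedAddCommGroup V] [NormedSpace ℝ V] [NormedAddCommGroup W]
    [NormedSpace ℝ W] {k : ℕ} (c : ℂ) (T : V [⋀^Fin k]→L[ℝ] ℂ) (g : W →L[ℝ] V) :
    (c • T).compContinuousLinearMap g = c • T.compContinuousLinearMap g := by
  ext u; rfl

/-- **`F(x) = (−1)^g χ(d) · (φ_H⁻¹)^*(w(x)_m)`** for every `x ∈ Hᵏ(X; ℂ)`, `k + m = 2g`: the cohomological Fourier transform of a complex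
torus with a Riemann form `η` of type `d` IS the Weyl operator of the Lefschetz `𝔰𝔩₂` of `(X, η)` — its degree-`m` component —
transported to `X̂` along the `ℂ`-linear isomorphism `φ_H : V ⥲ Ω̄` (`phiHEquiv`, Lemma 1.4.5: `η` is non-degenerate of type `(1,1)`),
times `(−1)^g χ(d)`, `χ(d) = d₁⋯d_g`. (Row g51-#5 `weylOperator_of` composed with `(φ_H⁻¹)^*`; `φ_H^* ∘ (φ_H⁻¹)^* = id`.)
[cite: Polishchuk2007FourierStable, §1 Lemma 1.4 (p. 3)] [cite: Lange2023AbelianVarietiesComplex, §6.2.4 (6.11) p. 311, Prop. 6.2.20 p. 310; §1.4.2 Lemma 1.4.5]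
[cite: Lang1982AbelianFunctions, Ch. VII §5 (p. 119)] -/
theorem IsPolarizationType.fourierForm_eq_smul_weylOperator_compContinuousLinearMap_phiHEquiv_symm (hR : IsRiemannForm Φ η)
    {g : ℕ} {d : Fin g → ℕ} (hd : IsPolarizationType Φ η d) (hη : ∀ v : E, v ≠ 0 → ∃ w : E, η ![v, w] ≠ 0) (e : Fin N ≃ ι)
    {k m : ℕ} (h : k + m = N) (x : E [⋀^Fin k]→L[ℝ] ℂ) :
    fourierForm Φ e h x =
      ((-1 : ℂ) ^ g * ∏ i, (d i : ℂ)) •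
        ((hasLefschetzProperty_lefschetzG hη).weylOperator isZGrading_countingG (GForm.of k x) m).compContinuousLinearMap
          (((phiHEquiv Φ hR.1 hR.nondegenerate).symm : (E →L⋆[ℂ] ℂ) →L[ℂ] E).restrictScalars ℝ) := by
  have key := congr_fun (hd.of_fourierForm_compContinuousLinearMap Φ hR hη ((phiHRep Φ hR.1).restrictScalars ℝ)
    (fun u w ↦ im_phiHFun η u w) e h x) m
  rw [GForm.of_apply_self, Pi.smul_apply] at key
  rw [← smul_compContinuousLinearMap₅₆, ← key]
  ext v
  simp only [ContinuousAlternatingMap.compContinuousLinearMap_apply, Function.comp_def, ContinuousLinearMap.coe_restrictScalars',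
    ContinuousLinearEquiv.coe_coe, phiHRep_apply, phiHFun_phiHEquiv_symm_apply]

end FourierClosedForm

end ComplexTorus

end Literature.Geometry.Kaehler

end
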